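import Summits.PneNP.PneNP.Theorems.SymmetryBudgetWindowCanoniserSemMain4
import Literature.Computability.Complexity.GraphCanonizationSchemeSize

/-!
# Window canoniser, XXIII: the trajectory of a replay

Route `PneNP/SymmetryBudget`, dichotomy `WindowBarrier` (stmt-PneNP-2145) / `NoHiddenOrder` (stmt-PneNP-14781);
continuation of `…WindowCanoniserSemMain4.lean` (mathematical side only: the replay `WCan.rs L x` of
`…WindowCanoniserReplayDefs.lean`).  Along a replay the vertex set shrinks, the consumed set grows inside `X`,
the colouring only REFINES its kernel on the current vertex set (`WCan.rs_ker`), consumed vertices are colour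
singletons (`WCan.singInv_rs`), `dead` is monotone, `arr` records an earlier arrival (`WCan.rs_arr_iff`), a
frozen state stays put (`WCan.rs_frozen`); hence **an OK replay ends at its label**:
`WCan.finSt_eq_of_okP : okP L x → (finSt L x).W = L.U ∧ (finSt L x).C = L.X`.
-/

-- `Summit.PneNP.PneNP.…` duplicates `PneNP` BY DESIGN (single-problem summit, D-0017 layout).
set_option linter.dupNamespace false

noncomputable section

namespace Summit.PneNP.PneNP.Theorems

namespace WCan

open Finset Literature.Computability.Complexity Literature.Computability.Complexity.CGCanon
  Literature.Combinatorics.SimpleGraph ColourRefinementScheme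
open scoped Classical

variable {K r n : ℕ} (L : RawLab n) (x : Fin (r + n) × Fin (r + n) → Bool)

/-! ### One step -/

/-- The selected vertices lie in `W`. -/
theorem selSet_subset_W (S : St n) : selSet L S ⊆ S.W := fun _ hv =>
  (mem_bigMinCell.1 (mem_inter.1 (mem_filter.1 hv).1).1).1

/-- The selected vertices lie in `X`. -/
theorem selSet_subset_X (S : St n) : selSet L S ⊆ L.X := fun _ hv =>
  (mem_sdiff.1 (mem_inter.1 (mem_filter.1 hv).1).2).1

/-- A step does not enlarge the vertex set. -/
theorem step_W_subset (S : St n) : (step L x S).W ⊆ S.W := by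
  simp only [step]
  split_ifs
  · exact Subset.rfl
  · exact Subset.rfl
  · exact filter_subset _ _

/-- A step does not shrink the consumed set. -/
theorem step_C_subset (S : St n) : S.C ⊆ (step L x S).C := by
  simp only [step]
  split_ifs
  · exact Subset.rfl
  · exact subset_union_left
  · exact Subset.rfl

/-- The consumed set stays inside `X`. -/
theorem step_C_subset_X {S : St n} (h : S.C ⊆ L.X) : (step L x S).C ⊆ L.X := by
  simp only [step]
  split_ifs
  · exact h
  · exact union_subset h (selSet_subset_X L S)
  · exact h

/-- The refined colouring at an individualisation step refines `c`. -/
theorem indCol_eq_of_eq {S : St n} {u v : Fin n} (h : indCol L S u = indCol L S v) : S.c u = S.c v := by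
  unfold indCol at h
  split_ifs at h
  · exact eq_of_individualize_eq h
  · exact h

/-- **A step only refines the kernel of the colouring on the new vertex set.** -/
theorem step_ker (S : St n) {u v : Fin n} (hu : u ∈ (step L x S).W) (hv : v ∈ (step L x S).W)
    (h : (step L x S).c u = (step L x S).c v) : S.c u = S.c v := by
  simp only [step] at hu hv h
  split_ifs at hu hv h with h1 h2
  · exact h
  · exact indCol_eq_of_eq L (crRefine_refines hu hv h)
  · exact h

/-- `dead` is monotone. -/
theorem step_dead_mono {S : St n} (h : S.dead = true) : (step L x S).dead = true := by
  simp [step, h]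

/-- `arr` after a step. -/
theorem step_arr (S : St n) : (step L x S).arr = (S.arr || decide (nowP L S)) := rfl

/-! ### Along the trajectory -/

/-- The vertex sets shrink. -/
theorem rs_W_anti {t t' : ℕ} (h : t ≤ t') : (rs L x t').W ⊆ (rs L x t).W := by
  induction h with
  | refl => exact Subset.rfl
  | step _ ih => rw [rs_succ]; exact (step_W_subset L x _).trans ih

/-- The consumed sets grow. -/
theorem rs_C_mono {t t' : ℕ} (h : t ≤ t') : (rs L x t).C ⊆ (rs L x t').C := by
  induction h with
  | refl => exact Subset.rfl
  | step _ ih => rw [rs_succ]; exact ih.trans (step_C_subset L x _)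

/-- The consumed set stays inside `X`. -/
theorem rs_C_subset_X (t : ℕ) : (rs L x t).C ⊆ L.X := by
  induction t with
  | zero => simp [initSt]
  | succ t ih => rw [rs_succ]; exact step_C_subset_X L x ih

/-- **Kernels only refine along the trajectory.** -/
theorem rs_ker {t t' : ℕ} (h : t ≤ t') {u v : Fin n} (hu : u ∈ (rs L x t').W) (hv : v ∈ (rs L x t').W)
    (he : (rs L x t').c u = (rs L x t').c v) : (rs L x t).c u = (rs L x t).c v := by
  induction h with
  | refl => exact he
  | step _ ih =>
    rw [rs_succ] at hu hv he
    exact ih (step_W_subset L x _ hu) (step_W_subset L x _ hv) (step_ker L x _ hu hv he)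

/-- `dead` is monotone along the trajectory. -/
theorem rs_dead_mono {t t' : ℕ} (h : t ≤ t') (hd : (rs L x t).dead = true) : (rs L x t').dead = true := by
  induction h with
  | refl => exact hd
  | step _ ih => rw [rs_succ]; exact step_dead_mono L x ih

/-- **`arr` records an earlier arrival.** -/
theorem rs_arr_iff (t : ℕ) : (rs L x t).arr = true ↔ ∃ s < t, nowP L (rs L x s) := by
  induction t with
  | zero => simp [initSt]
  | succ t ih =>
    rw [rs_succ, step_arr, Bool.or_eq_true, ih, decide_eq_true_iff]
    constructor
    · rintro (⟨s, hs, h⟩ | h)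
      · exact ⟨s, by omega, h⟩
      · exact ⟨t, by omega, h⟩
    · rintro ⟨s, hs, h⟩
      rcases Nat.lt_succ_iff_lt_or_eq.1 hs with hs | rfl
      · exact Or.inl ⟨s, hs, h⟩
      · exact Or.inr h

/-- **A frozen state stays put.** -/
theorem rs_frozen {t t' : ℕ} (hf : frzP L (rs L x t)) (h : t ≤ t') :
    (rs L x t').W = (rs L x t).W ∧ (rs L x t').c = (rs L x t).c ∧ (rs L x t').C = (rs L x t).C ∧
      (rs L x t').dead = (rs L x t).dead ∧ frzP L (rs L x t') := by
  induction h with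
  | refl => exact ⟨rfl, rfl, rfl, rfl, hf⟩
  | step _ ih =>
    obtain ⟨hW, hc, hC, hd, hf'⟩ := ih
    obtain ⟨hW', hc', hC', hd', hf''⟩ := step_of_frz L x hf'
    rw [rs_succ]
    exact ⟨hW'.trans hW, hc'.trans hc, hC'.trans hC, hd'.trans hd, hf''⟩

/-- **An OK replay ends at its label**: the final vertex set is `U` and the final consumed set is `X`. -/
theorem finSt_eq_of_okP (h : okP L x) : (finSt L x).W = L.U ∧ (finSt L x).C = L.X := by
  obtain ⟨s, hs, hnow⟩ := (rs_arr_iff L x (T n)).1 h.1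
  obtain ⟨hW, -, hC, -⟩ := rs_frozen L x (t := s) (Or.inr (Or.inl hnow)) hs.le
  exact ⟨hW.trans hnow.1, hC.trans hnow.2⟩

/-! ### Consumed vertices are colour singletons -/

/-- Every consumed vertex still present is alone in its colour class. -/
def SingInv (S : St n) : Prop := ∀ y ∈ S.C, y ∈ S.W → ∀ v ∈ S.W, S.c v = S.c y → v = y

/-- The refiner of the tree, unfolded. -/
theorem crRefiner_refine (G' : SimpleGraph (Fin n)) (W : Finset (Fin n)) (c : Fin n → ℕ) :
    (crRefiner n).refine G' W c = crRefine G' W c := rfl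

/-- The singleton invariant is preserved by a step. -/
theorem singInv_step {S : St n} (h : SingInv S) : SingInv (step L x S) := by
  intro y hy hyW v hv hc
  have hyW0 := step_W_subset L x S hyW
  have hvW0 := step_W_subset L x S hv
  have hc0 := step_ker L x S hv hyW hc
  by_cases hyC : y ∈ S.C
  · exact h y hyC hyW0 v hvW0 hc0
  · -- `y` was consumed at this very step: an unfrozen individualisation step selecting `y`
    simp only [step] at hy hyW hv hc
    split_ifs at hy hyW hv hc with h1 h2
    · exact absurd hy hyC
    · rw [mem_union] at hy
      have hysel : y ∈ selSet L S := hy.resolve_left hyC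
      have hne : (selSet L S).Nonempty := ⟨y, hysel⟩
      have hmin : (selSet L S).min' hne = y := by
        have := selSet_eq_singleton L hysel
        simp [this]
      have hind : indCol L S = individualize S.c y := by unfold indCol; rw [dif_pos hne, hmin]
      rw [hind, ← crRefiner_refine] at hc
      exact eq_of_refine_individualize_eq_self (crRefiner n) (G x) S.W S.c hyW hv hc
    · exact absurd hy hyC

/-- **Consumed vertices are colour singletons**, all along the trajectory. -/
theorem singInv_rs (t : ℕ) : SingInv (rs L x t) := by
  induction t with
  | zero => intro y hy; simp [initSt] at hy
  | succ t ih => rw [rs_succ]; exact singInv_step L x ih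

/-- In an OK final state, a vertex of `X ∩ U` is alone in its colour class on `U`. -/
theorem final_single_of_okP (h : okP L x) {y : Fin n} (hy : y ∈ L.X) (hyU : y ∈ L.U) {v : Fin n} (hv : v ∈ L.U)
    (hc : (finSt L x).c v = (finSt L x).c y) : v = y := by
  obtain ⟨hW, hC⟩ := finSt_eq_of_okP L x h
  exact singInv_rs L x (T n) y (hC ▸ hy) (hW ▸ hyU) v (hW ▸ hv) hc

end WCan

end Summit.PneNP.PneNP.Theorems

end
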